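import Summits.QuantumFields.YangMills.Theorems.BalabanUVNodesN15KingModelPotentialSiteGradSizeOnly
import Summits.QuantumFields.YangMills.Theorems.BalabanUVNodesN15KingModelPotentialUnitSizeOnlyByName

/-!
# N15 (NE2⁺), King-model rung, part 24: THE SLOT DECISION — which regularity slot the dressed King layers need, decided by theorems both ways

Cell `pub-ymgap-dag-n15-d` (R134 acceleration DAG, node N15 = NE2, strategy s3 KING-MODEL RUNG), part 24 (capstone of parts 8b–23b; ONE citation point
for referees and planners; no new estimate).  [B9]'s background-dependent layers are typed in the tree with two regularity slots, (3.35) (read by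
`NE2PlusOperator`∕`NE2PlusSite`) and (3.36) (read, with (3.35), by `NE2PlusUnit`).  In King's A = 0 model dressed by POTENTIAL TOWERS the lineage realised
the slots in two ways — part 8c's `potBg` ((3.35) := size, (3.36) := one-step coherence) and part 15's `potBgSC` ((3.35) := size ∧ coherence) — and this
file records, as ONE conjunction per family, what holds BY NAME and what FAILS:

* ★★ `n15_kingModel_slotDecision`: (A) on the size-and-coherence family `kingInstanceSC`: `NE2PlusSite` for BOTH (3.133) sup entries of the dressed
  minimiser (p = 0: part 15; p = 1: part 19b) and `NE2PlusUnit` for the dressed covariances (part 15∕10d) HOLD; (B) on the size-only family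
  `kingInstanceV`: `NE2PlusUnit` HOLDS (it reads the coherence slot; part 10d) but `NE2PlusSite` FAILS for both sup entries (parts 21, 23b); (C) on the
  size-only SORT `kingInstanceSize` ((3.36) := `True`, part 22b): `NE2PlusUnit` FAILS by name (parts 22∕22b);
* ★ `n15_kingModel_letterDecision`: the (H3) two-spacing letter of the first-variation tower HOLDS for coherent towers (part 8b) and FAILS for some
  size-regular tower in every window (part 20).

HONEST SCOPE.  King's A = 0 scalar model on the King-admissible tori `Π ℤ∕(2L^{e+1})`, odd `L ≥ 3`, `a, m² > 0`, `c₃₅ > 0`, `0 ≤ s ≤ L^{−1∕2}`,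
`0 < γ < 1`; scalar potentials (NOT gauge fields); OUR slot readings; statements about THIS LINEAGE's families, not about printed propositions and not
about Bałaban's `H_k(U)` ∕ `C^{(k)}(Λ;U)`; count-neutral (`--supports`), not a discharge of N15; THEOREMS ONLY (0 `def`, 0 `sorry`).

References: [B9] = Bałaban, Commun. Math. Phys. 102 (1985) 385–462, (3.35)–(3.36) p.396, (3.133) p.422, Thm 3.14 pp.426–427, Thm 3.15 (3.187) p.432
(quantifier templates) (bib key `Balaban1985BackgroundPropagators`); C. King, Commun. Math. Phys. 102 (1986) 649–677, Prop. 3.8 (3.71) p.664,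
Lemma 4.5 (4.38) p.674 (A = 0 model) (bib key `King1986`).
-/

noncomputable section
open scoped BigOperators

namespace Summit.QuantumFields.YangMills.BalabanUVNodes.N15.KingModel

open Literature.MathematicalPhysics.QuantumFieldTheory.Balaban1983to89 hiding blockOf
open Literature.MathematicalPhysics.QuantumFieldTheory.Balaban1983to89.T4EtaRate (NE2PlusSite NE2PlusUnit)
open Literature.MathematicalPhysics.QuantumFieldTheory.Balaban1983to89.B5Prop11Plancherel (Tor fine)
open Summit.QuantumFields.BalabanUV.T4Continuum.NE2KingTransplant (EffectiveOperatorSupRate)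
open Summit.QuantumFields.YangMills.BalabanUVNodes.N15KingModelRung.Curved (underPtN)

variable {d : ℕ} (L : ℕ) [NeZero L]

/-- **THE SLOT DECISION FOR THE DRESSED KING LAYERS** (module docstring): (A) size-AND-coherence family — `NE2PlusSite` (p = 0) ∧ `NE2PlusSite` (p = 1) ∧
`NE2PlusUnit` HOLD; (B) size-only (3.35) slot, coherence in (3.36) — `NE2PlusUnit` HOLDS (reads the coherence slot) ∧ `¬NE2PlusSite` (p = 0) ∧
`¬NE2PlusSite` (p = 1); (C) size-only sort with a vacuous (3.36) slot — `¬NE2PlusUnit` by name.  HONEST SCOPE: module docstring.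
[cite: Balaban1985BackgroundPropagators, (3.35)–(3.36) p.396 + Thm 3.14 pp.426–427 + Thm 3.15 (3.187) p.432 (quantifier templates); King1986, Prop. 3.8 (3.71) p.664 + Lemma 4.5 (4.38) p.674 (A = 0 model)] -/
theorem n15_kingModel_slotDecision (hLodd : Odd L) (hL : 2 ≤ L) {a m2 : ℝ} (ha : 0 < a) (hm : 0 < m2) {c35 : ℝ} (hc : 0 < c35)
    {s : ℝ} (hs0 : 0 ≤ s) (hs1 : s ≤ (L : ℝ) ^ (-(1 / 2 : ℝ))) {γ : ℝ} (hγ0 : 0 < γ) (hγ1 : γ < 1) (d' : ℕ) (p : ℝ) :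
    (NE2PlusSite d' p c35 (kingInstanceSC (d := d) L s) (kingHSiteSC L a m2 s)
      ∧ NE2PlusSite d' p c35 (kingInstanceSC (d := d) L s) (dkingHSiteSC L a m2 s)
      ∧ NE2PlusUnit c35 (kingInstanceSC (d := d) L s) (kingKerSC L a m2 s) (fun _ _ => True) (kingDistSC L s))
    ∧ (NE2PlusUnit c35 (kingInstanceV (d := d) L s) (kingKerVW L a m2 s) (fun _ _ => True) (kingDistV L s)
      ∧ ¬ NE2PlusSite d' p c35 (kingInstanceV (d := d) L s) (kingHSiteV L a m2 s)
      ∧ ¬ NE2PlusSite d' p c35 (kingInstanceV (d := d) L s) (dkingHSiteV L a m2 s))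
    ∧ ¬ NE2PlusUnit c35 (kingInstanceSize (d := d) L) (kingKerSize L a m2) (fun _ _ => True) (kingDistSize L) :=
  ⟨⟨ne2PlusSite_kingHSC L hLodd hL ha hm hc hs0 hs1 d' p, ne2PlusSite_dkingHSC L hLodd hL ha hm hc hγ0 hγ1 hs0 hs1 d' p,
      ne2PlusUnit_kingSC L hLodd hL ha hm hc hs0 hs1⟩,
    ⟨ne2PlusUnit_kingVW L hLodd hL ha hm hc hs0 hs1, not_ne2PlusSite_kingHV L hLodd hL ha hm hc s d' p,
      not_ne2PlusSite_dkingHV L hLodd hL ha hm hc s d' p⟩, not_ne2PlusUnit_kingSize L hL ha hm hc⟩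

/-- **THE LETTER DECISION**: King's (H3) two-spacing letter for the first-variation tower HOLDS along every COHERENT potential tower of size `≤ w₀`
(rate `L^{−1∕2}`, part 8b `potTower_letters_kingU`) and FAILS for some size-regular tower of size `≤ w₀` against every `(ε, r < 1)` (part 20
`potTower_supRate_false_without_coherence`) — on every King-admissible torus. [cite: King1986, Prop. 3.8 (3.71) p.664 + (2.13)–(2.14) p.653 (A = 0 model)] -/
theorem n15_kingModel_letterDecision (hLodd : Odd L) (hL : 2 ≤ L) {a m2 : ℝ} (ha : 0 < a) (hm : 0 < m2) :
    (∃ c : ℝ, 0 < c ∧ ∀ (e : ℕ) (v : ∀ N : ℕ, Tor (fine N (kingU d L e)) → ℝ) (w₀ : ℝ),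
        (∀ (N : ℕ) (x : Tor (fine N (kingU d L e))), |v N x| ≤ w₀) →
        ∀ (ν₀ s : ℝ), 0 ≤ ν₀ → 0 ≤ s → s ≤ (L : ℝ) ^ (-(1 / 2 : ℝ)) →
          (∀ (k : ℕ), 1 ≤ k → ∀ x' : Tor (fine (L ^ 1 * L ^ k) (kingU d L e)),
              |v (L ^ 1 * L ^ k) x' - v (L ^ k) (underPtN L k 1 (kingU d L e) x')| ≤ ν₀ * s ^ k) →
          EffectiveOperatorSupRate (potTower L (kingU d L e) a m2 v) (c * (w₀ + ν₀)) ((L : ℝ) ^ (-(1 / 2 : ℝ))))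
    ∧ ∀ (e : ℕ) {w₀ : ℝ}, 0 < w₀ → ∀ (ε : ℝ) {r : ℝ}, 0 ≤ r → r < 1 →
        ∃ v : ∀ N : ℕ, Tor (fine N (kingU d L e)) → ℝ, (∀ (N : ℕ) (x : Tor (fine N (kingU d L e))), |v N x| ≤ w₀) ∧
          ¬ EffectiveOperatorSupRate (potTower L (kingU d L e) a m2 v) ε r := by
  obtain ⟨κ, c, hκ, hc, H⟩ := potTower_letters_kingU (d := d) L hLodd hL ha hm
  exact ⟨⟨c, hc, fun e v w₀ hv ν₀ s hν hs0 hs1 hcoh => (H e v w₀ hv).2 ν₀ s hν hs0 hs1 hcoh⟩,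
    fun e w₀ hw₀ ε r hr0 hr1 => potTower_supRate_false_without_coherence (d := d) L hL ha hm (kingU d L e) hw₀ ε hr0 hr1⟩

end Summit.QuantumFields.YangMills.BalabanUVNodes.N15.KingModel

end
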